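import Summits.RiemannHypothesis.RiemannHypothesis.Theorems.IntegerScrewScrewPolyFloorZeroExpansion
import Summits.RiemannHypothesis.RiemannHypothesis.Theorems.IntegerScrewDefs
import HarnessLib

/-!
# Splittings — SCREW BRIDGE g5, the form dictionary: `zᵀ S_n z` and the kernel form at real positions as series over the zeros

Zero-def carve (seat rh-split-typer-2 g3, R10.8 hand-on of `cards/SPLIT-screw-bridge.md` §10) of §4–§5 and §8 of the scratch of
record `HOME/rh-split-screw-bridge/ScrewBridgeG5.lean` (sha16 c26d31e4e9941ae1, seat rh-split-screw-bridge g5; farm rc 0 / 0 sorry,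
std axioms); declaration blocks byte-identical, original namespace kept; §1–§3 of the scratch (alternative R2 record, superseded by
the tree's `ScrewNullComb.nnc`) are NOT carved; §6, §7, §9 are the companion file `ScrewNodeReduction.lean`.
CONTENT (kernel, unconditional): `hasSum_nodeFunctional` (Suzuki (1.9) for a finite combination of kernel sections, from the tree's
`IntegerScrewLandau.hasSum_kernel`), `screwForm_quad_identity`, `hasSum_screwForm` —
`zᵀ S_n z = −Σ_ρ (m_ρ/(ρ−½)²)·P_z(ρ−½)·P_z(−(ρ−½))`, `P_z(s) = Σ_j z_j (e^{s·log(j+2)} − 1)`; `hasSum_pointFunctional`,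
`hasSum_kernelForm` — the same at arbitrary real positions; `pointSum_of_sum_eq_zero` — for MEAN-ZERO coefficient vectors the
`−1`s drop: the screw form is Weil's translation-invariant form `−Σ_ρ (m/a²) μ̂(a) μ̂(−a)` (`a = ρ−½`) on mean-zero atomic measures
(on-line zeros contribute `(m/γ²)|μ̂(iγ)|² ≥ 0`, off-line quadruples hyperbolic terms).  [folklore]/[new] as tagged per decl.

HONEST LABEL (cell rh-split): SPLITTING SEARCH over kernel-typed RH-EQUIVALENCES; a splitting A ∧ B ⟹ RH is CONDITIONAL
bookkeeping unless A and B are both proved; nothing here bears on the truth of RH.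
-/

set_option linter.dupNamespace false

noncomputable section

namespace Summit.RiemannHypothesis.RiemannHypothesis.Theorems.Splittings.ScrewBridgeG5

open Filter Topology Finset Complex
open Literature.NumberTheory.LFunctions
open Summit.RiemannHypothesis.RiemannHypothesis.Theorems.IntegerScrew

/-! ## §4 The dictionary, certified: a finite combination of kernel sections as a series over the zeros -/

/-- **Zero expansion of the node functional** (from the tree's unconditional kernel expansion
`IntegerScrewLandau.hasSum_kernel`, Suzuki 2023 (1.9)): for real `t` and `z : Fin n → ℝ`,
`Σ_j G(t, log(j+2)) z_j = Σ_ρ Σ_j z_j (m_ρ/(ρ−½)²)·[(e^{(ρ−½)t}(1 − (j+2)^{−(ρ−½)}) + e^{−(ρ−½)t}(1 − (j+2)^{ρ−½}))/2 + (cosh((ρ−½)log(j+2)) − 1)]`,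
a `HasSum` over the subtype of non-trivial zeros (absolutely convergent, no hypothesis on the zeros).
Swapping the finite sum: `F_z(t) = Σ_ρ (m_ρ/(ρ−½)²)[(e^{(ρ−½)t} E_z(ρ−½) + e^{−(ρ−½)t} E_z(−(ρ−½)))/2 + B_z(ρ−½)]`
with `E_z(s) = Σ_j z_j(1 − e^{−s log(j+2)})`, `B_z(s) = Σ_j z_j(cosh(s log(j+2)) − 1)` — the dictionary
behind the node-peeling statement (A): growth rate `Re(ρ−½)`, frequency `Im(ρ−½)`, coefficient
`E_z(ρ−½)` (the `ρ ↦ 1−ρ` symmetry of the zero set merges the two exponentials). [folklore] -/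
theorem hasSum_nodeFunctional (t : ℝ) (n : ℕ) (z : Fin n → ℝ) :
    HasSum (fun ρ : ZetaZeros.riemannZetaNontrivialZeros => ∑ j : Fin n, ((z j : ℝ) : ℂ) *
      ((riemannZetaZeroOrder (ρ : ℂ) : ℂ) / ((ρ : ℂ) - 1 / 2) ^ 2 *
        ((cexp (((ρ : ℂ) - 1 / 2) * (t : ℂ)) *
              (1 - cexp (-(((ρ : ℂ) - 1 / 2) * (Real.log (((j : ℕ) + 2 : ℕ) : ℝ) : ℂ)))) +
            cexp (-(((ρ : ℂ) - 1 / 2) * (t : ℂ))) *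
              (1 - cexp (((ρ : ℂ) - 1 / 2) * (Real.log (((j : ℕ) + 2 : ℕ) : ℝ) : ℂ)))) / 2 +
          (Complex.cosh (((ρ : ℂ) - 1 / 2) * (Real.log (((j : ℕ) + 2 : ℕ) : ℝ) : ℂ)) - 1))))
      ((∑ j : Fin n, zetaScrewKernel t (Real.log (((j : ℕ) + 2 : ℕ) : ℝ)) * z j : ℝ) : ℂ) := by
  have h := hasSum_sum (s := (Finset.univ : Finset (Fin n))) fun j _ =>
    (IntegerScrewLandau.hasSum_kernel t (Real.log (((j : ℕ) + 2 : ℕ) : ℝ))).mul_right ((z j : ℝ) : ℂ)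
  push_cast at h ⊢
  refine h.congr_fun fun ρ => Finset.sum_congr rfl fun j _ => ?_
  have hcosh : ∀ x : ℂ, Complex.cosh x = (cexp x + cexp (-x)) / 2 := fun x => by
    rw [eq_div_iff two_ne_zero, mul_comm, Complex.two_cosh]
  have e1 : cexp (((ρ : ℂ) - 1 / 2) * ((t : ℂ) - (Real.log (((j : ℕ) : ℝ) + 2) : ℂ))) =
      cexp (((ρ : ℂ) - 1 / 2) * (t : ℂ)) *
        cexp (-(((ρ : ℂ) - 1 / 2) * (Real.log (((j : ℕ) : ℝ) + 2) : ℂ))) := by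
    rw [← Complex.exp_add]
    ring_nf
  have e2 : cexp (-(((ρ : ℂ) - 1 / 2) * ((t : ℂ) - (Real.log (((j : ℕ) : ℝ) + 2) : ℂ)))) =
      cexp (-(((ρ : ℂ) - 1 / 2) * (t : ℂ))) *
        cexp (((ρ : ℂ) - 1 / 2) * (Real.log (((j : ℕ) : ℝ) + 2) : ℂ)) := by
    rw [← Complex.exp_add]
    ring_nf
  simp only [hcosh]
  rw [e1, e2]
  ring

/-- Algebraic kernel of `hasSum_screwForm`: for each zero, the double node sum of the expansion
collapses to `−w·P(a)·P(−a)` (the difference of the two sides is an antisymmetric double sum). [folklore] -/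
theorem screwForm_quad_identity (n : ℕ) (c : Fin n → ℂ) (w : ℂ) (X Y : Fin n → ℂ) :
    ∑ i : Fin n, c i * ∑ j : Fin n, c j *
        (w * ((X i * (1 - Y j) + Y i * (1 - X j)) / 2 + ((X j + Y j) / 2 - 1))) =
      -w * ((∑ j : Fin n, c j * (X j - 1)) * (∑ j : Fin n, c j * (Y j - 1))) := by
  have hA : ∀ i j : Fin n,
      c i * (c j * (w * ((X i * (1 - Y j) + Y i * (1 - X j)) / 2 + ((X j + Y j) / 2 - 1)))) -
        -w * (c i * (X i - 1) * (c j * (Y j - 1))) =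
      w / 2 * (c i * c j) * (X i * Y j - Y i * X j - X i + X j + Y i - Y j) := by
    intro i j; ring
  rw [← sub_eq_zero, Finset.sum_mul_sum, Finset.mul_sum]
  simp_rw [Finset.mul_sum]
  rw [← Finset.sum_sub_distrib]
  simp_rw [← Finset.sum_sub_distrib, hA]
  have hanti : ∑ i : Fin n, ∑ j : Fin n, w / 2 * (c i * c j) * (X i * Y j - Y i * X j - X i + X j + Y i - Y j) =
      -∑ i : Fin n, ∑ j : Fin n, w / 2 * (c i * c j) * (X i * Y j - Y i * X j - X i + X j + Y i - Y j) := by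
    conv_lhs => rw [Finset.sum_comm]
    rw [← Finset.sum_neg_distrib]
    refine Finset.sum_congr rfl fun i _ => ?_
    rw [← Finset.sum_neg_distrib]
    exact Finset.sum_congr rfl fun j _ => by ring
  have h2 : (2 : ℂ) * ∑ i : Fin n, ∑ j : Fin n,
      w / 2 * (c i * c j) * (X i * Y j - Y i * X j - X i + X j + Y i - Y j) = 0 := by
    linear_combination hanti
  exact (mul_eq_zero.1 h2).resolve_left two_ne_zero

/-- **The screw form is Weil's quadratic form on node measures** (zero side, unconditional):
`zᵀ S_n z = −Σ_ρ (m_ρ/(ρ−½)²)·P_z(ρ−½)·P_z(−(ρ−½))`, `P_z(s) = Σ_j z_j (e^{s log(j+2)} − 1)`, as an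
absolutely convergent `HasSum` over the non-trivial zeros (from `hasSum_nodeFunctional`).  For an on-line
zero `ρ = ½ + iγ` the term is `(m/γ²)|P_z(iγ)|² ≥ 0`; an off-line quadruple contributes the hyperbolic
term `−4m·Re(P_z(a)P_z(−a)/a²)`.  Since `P_z(s) = μ̂(s)` for the mean-zero measure `μ = Σ_j z_j δ_{log(j+2)} −
(Σ_j z_j)δ_0`, this identifies `S_n` with the translation-invariant form `−∬ g(t−u)dμdμ` on mean-zero
measures carried by the nodes `log 1, …, log(n+1)` — the dictionary behind the g5 analysis of R3. [folklore] -/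
theorem hasSum_screwForm (n : ℕ) (z : Fin n → ℝ) :
    HasSum (fun ρ : ZetaZeros.riemannZetaNontrivialZeros =>
      -((riemannZetaZeroOrder (ρ : ℂ) : ℂ) / ((ρ : ℂ) - 1 / 2) ^ 2) *
        ((∑ j : Fin n, ((z j : ℝ) : ℂ) *
            (cexp (((ρ : ℂ) - 1 / 2) * (Real.log (((j : ℕ) + 2 : ℕ) : ℝ) : ℂ)) - 1)) *
          (∑ j : Fin n, ((z j : ℝ) : ℂ) *
            (cexp (-(((ρ : ℂ) - 1 / 2) * (Real.log (((j : ℕ) + 2 : ℕ) : ℝ) : ℂ))) - 1))))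
      ((star z ⬝ᵥ (screwMatrix n).mulVec z : ℝ) : ℂ) := by
  have h := hasSum_sum (s := (Finset.univ : Finset (Fin n))) fun i _ =>
    (hasSum_nodeFunctional (Real.log (((i : ℕ) + 2 : ℕ) : ℝ)) n z).mul_left ((z i : ℝ) : ℂ)
  have hval : ((star z ⬝ᵥ (screwMatrix n).mulVec z : ℝ) : ℂ) =
      ∑ i : Fin n, ((z i : ℝ) : ℂ) *
        ((∑ j : Fin n, zetaScrewKernel (Real.log (((i : ℕ) + 2 : ℕ) : ℝ))
          (Real.log (((j : ℕ) + 2 : ℕ) : ℝ)) * z j : ℝ) : ℂ) := by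
    simp only [dotProduct, Matrix.mulVec, screwMatrix, Matrix.of_apply, star_trivial]
    push_cast
    rfl
  rw [hval]
  refine h.congr_fun fun ρ => ?_
  have hcosh : ∀ x : ℂ, Complex.cosh x = (cexp x + cexp (-x)) / 2 := fun x => by
    rw [eq_div_iff two_ne_zero, mul_comm, Complex.two_cosh]
  simp only [hcosh]
  exact (screwForm_quad_identity n (fun j => ((z j : ℝ) : ℂ))
    ((riemannZetaZeroOrder (ρ : ℂ) : ℂ) / ((ρ : ℂ) - 1 / 2) ^ 2)
    (fun j => cexp (((ρ : ℂ) - 1 / 2) * (Real.log (((j : ℕ) + 2 : ℕ) : ℝ) : ℂ)))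
    (fun j => cexp (-(((ρ : ℂ) - 1 / 2) * (Real.log (((j : ℕ) + 2 : ℕ) : ℝ) : ℂ))))).symm

/-! ## §8 The kernel form at real positions is Weil's form (dictionary for the paper construction)

`Σ_{p,p'} β_p β_{p'} G_g(x_p, x_{p'}) = −Σ_ρ (m_ρ/(ρ−½)²)·P_β(ρ−½)·P_β(−(ρ−½))`, `P_β(s) = Σ_p β_p (e^{s x_p} − 1)`,
for arbitrary real positions — the zero side of the form whose negative directions §7 pushes to the nodes.  For a
mean-zero `β`, `P_β(s) = Σ_p β_p e^{s x_p} = μ̂_β(s)`: the form is `−Σ_ρ (m/a²) μ̂(a) μ̂(−a)`, each on-line zero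
contributing `(m/γ²)|μ̂(iγ)|² ≥ 0` and each off-line quadruple a hyperbolic term. -/

/-- The kernel functional `Σ_p β_p G_g(t, x_p)` expanded over the zeros, real positions. [folklore] -/
theorem hasSum_pointFunctional (t : ℝ) (r : ℕ) (x β : Fin r → ℝ) :
    HasSum (fun ρ : ZetaZeros.riemannZetaNontrivialZeros => ∑ p : Fin r, ((β p : ℝ) : ℂ) *
      ((riemannZetaZeroOrder (ρ : ℂ) : ℂ) / ((ρ : ℂ) - 1 / 2) ^ 2 *
        ((cexp (((ρ : ℂ) - 1 / 2) * (t : ℂ)) * (1 - cexp (-(((ρ : ℂ) - 1 / 2) * (x p : ℂ)))) +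
            cexp (-(((ρ : ℂ) - 1 / 2) * (t : ℂ))) * (1 - cexp (((ρ : ℂ) - 1 / 2) * (x p : ℂ)))) / 2 +
          (Complex.cosh (((ρ : ℂ) - 1 / 2) * (x p : ℂ)) - 1))))
      ((∑ p : Fin r, zetaScrewKernel t (x p) * β p : ℝ) : ℂ) := by
  have h := hasSum_sum (s := (Finset.univ : Finset (Fin r))) fun p _ =>
    (IntegerScrewLandau.hasSum_kernel t (x p)).mul_right ((β p : ℝ) : ℂ)
  push_cast at h ⊢
  refine h.congr_fun fun ρ => Finset.sum_congr rfl fun p _ => ?_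
  have hcosh : ∀ x : ℂ, Complex.cosh x = (cexp x + cexp (-x)) / 2 := fun x => by
    rw [eq_div_iff two_ne_zero, mul_comm, Complex.two_cosh]
  have e1 : cexp (((ρ : ℂ) - 1 / 2) * ((t : ℂ) - (x p : ℂ))) =
      cexp (((ρ : ℂ) - 1 / 2) * (t : ℂ)) * cexp (-(((ρ : ℂ) - 1 / 2) * (x p : ℂ))) := by
    rw [← Complex.exp_add]; ring_nf
  have e2 : cexp (-(((ρ : ℂ) - 1 / 2) * ((t : ℂ) - (x p : ℂ)))) =
      cexp (-(((ρ : ℂ) - 1 / 2) * (t : ℂ))) * cexp (((ρ : ℂ) - 1 / 2) * (x p : ℂ)) := by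
    rw [← Complex.exp_add]; ring_nf
  simp only [hcosh]
  rw [e1, e2]
  ring

/-- **The kernel form at real positions, zero side (kernel, unconditional):**
`Σ_{p,p'} β_p β_{p'} G_g(x_p,x_{p'}) = −Σ_ρ (m_ρ/(ρ−½)²) P_β(ρ−½) P_β(−(ρ−½))`. [new] -/
theorem hasSum_kernelForm (r : ℕ) (x β : Fin r → ℝ) :
    HasSum (fun ρ : ZetaZeros.riemannZetaNontrivialZeros =>
      -((riemannZetaZeroOrder (ρ : ℂ) : ℂ) / ((ρ : ℂ) - 1 / 2) ^ 2) *
        ((∑ p : Fin r, ((β p : ℝ) : ℂ) * (cexp (((ρ : ℂ) - 1 / 2) * (x p : ℂ)) - 1)) *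
          (∑ p : Fin r, ((β p : ℝ) : ℂ) * (cexp (-(((ρ : ℂ) - 1 / 2) * (x p : ℂ))) - 1))))
      ((∑ p : Fin r, ∑ p' : Fin r, β p * β p' * zetaScrewKernel (x p) (x p') : ℝ) : ℂ) := by
  have h := hasSum_sum (s := (Finset.univ : Finset (Fin r))) fun p _ =>
    (hasSum_pointFunctional (x p) r x β).mul_left ((β p : ℝ) : ℂ)
  have hval : ((∑ p : Fin r, ∑ p' : Fin r, β p * β p' * zetaScrewKernel (x p) (x p') : ℝ) : ℂ) =
      ∑ p : Fin r, ((β p : ℝ) : ℂ) * ((∑ p' : Fin r, zetaScrewKernel (x p) (x p') * β p' : ℝ) : ℂ) := by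
    push_cast
    refine Finset.sum_congr rfl fun p _ => ?_
    rw [Finset.mul_sum]
    exact Finset.sum_congr rfl fun p' _ => by ring
  rw [hval]
  refine h.congr_fun fun ρ => ?_
  have hcosh : ∀ x : ℂ, Complex.cosh x = (cexp x + cexp (-x)) / 2 := fun x => by
    rw [eq_div_iff two_ne_zero, mul_comm, Complex.two_cosh]
  simp only [hcosh]
  exact (screwForm_quad_identity r (fun p => ((β p : ℝ) : ℂ))
    ((riemannZetaZeroOrder (ρ : ℂ) : ℂ) / ((ρ : ℂ) - 1 / 2) ^ 2)
    (fun p => cexp (((ρ : ℂ) - 1 / 2) * (x p : ℂ)))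
    (fun p => cexp (-(((ρ : ℂ) - 1 / 2) * (x p : ℂ))))).symm

/-- For a mean-zero `β` the `−1`s drop out: `P_β(s) = Σ_p β_p e^{s x_p}`. [folklore] -/
theorem pointSum_of_sum_eq_zero {r : ℕ} (β : Fin r → ℝ) (hβ : ∑ p, β p = 0) (E : Fin r → ℂ) :
    ∑ p, ((β p : ℝ) : ℂ) * (E p - 1) = ∑ p, ((β p : ℝ) : ℂ) * E p := by
  have h : ∑ p, ((β p : ℝ) : ℂ) = 0 := by exact_mod_cast hβ
  simp only [mul_sub, mul_one, Finset.sum_sub_distrib, h, sub_zero]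

end Summit.RiemannHypothesis.RiemannHypothesis.Theorems.Splittings.ScrewBridgeG5

end
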